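import Summits.Ventures.CertifiedArithmetic.Expansions.RoundExpansion
import Summits.Ventures.CertifiedArithmetic.Expansions.CompressPenultimate
import Summits.Ventures.CertifiedArithmetic.Expansions.WeakExpansion
import Mathlib.Tactic.Linarith
import Mathlib.Tactic.NormNum

/-!
# ROUND-EXPANSION ∘ COMPRESS is the correctly rounded sum of an expansion (new work)

NEW WORK in the sense of this development (COMPRESS is Shewchuk's, §2.7 of [Shewchuk1997];
ROUND-EXPANSION, the statements and the proofs are ours).  For every precision `p ≥ 2`, EVERY
round-to-nearest `fl` (any tie rule, gradual underflow included) and every nonoverlapping expansion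
`e` of floats,

  `roundExpansion p emin fl (compress fl e) = fl (Σ e)`                (`roundExpansion_compress`)

— one COMPRESS (about `6m` flops) followed by one test and three flops return THE CORRECTLY ROUNDED
VALUE of the number the expansion represents, in the working rounding.  This is the glue of
* Theorem 23 (`compress_nonoverlapping`, `Literature/…/Shewchuk1997/Compress.lean`): `compress fl e`
  is a nonoverlapping expansion of floats with the same sum and no zero component — unless it is the
  single component `[Σ e]`, in which case `Σ e` is a float and ROUND-EXPANSION returns it;
* `compress_penultimate_near` (`CompressPenultimate.lean`): its last two components satisfy the
  roundoff condition;
* `roundExpansion_eq_fl_sum` (`RoundExpansion.lean`): on such expansions ROUND-EXPANSION returns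
  `fl` of the sum.
Variants: the input class stated with the paper's pairwise notions (`roundExpansion_compress'`:
pairwise nonoverlapping and increasing in magnitude except for zeros, the dictionary
`isExpansion_one_iff`), and with this development's class W of weakly nonoverlapping expansions
(`roundExpansion_compress_of_isWeakExpansion`) — the class FAST-EXPANSION-SUM actually preserves
(`WeakExpansion.lean`), so that "sum two expansions with FAST-EXPANSION-SUM, COMPRESS, ROUND" is a
correctly rounded sum of two expansions; and the half-ulp error form
(`abs_roundExpansion_compress_sub_sum_le`).

Why COMPRESS alone is not enough: its top component is only a faithful rounding of the sum
(`CompressTopFaithful.lean`; for `p = 4` the components below the top can add up to `17/32·ulp`),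
and APPROXIMATE (add the components smallest first) is not `fl (Σ e)` either
(`RoundExpansion.lean`, examples for `p = 3`).

HONEST FRAMING.  New work of this project, not the formalisation of a published theorem; Shewchuk's
paper stops at COMPRESS and APPROXIMATE [cite: Shewchuk1997, §2.7–2.8] and makes no claim about
correct rounding.  Nearest published setting: correctly rounded sums of arbitrary floating-point
sets are obtained by other means (long accumulators, error-free transformation cascades such as
Rump–Ogita–Oishi's AccSum/NearSum); the statement here is specific to Shewchuk's nonoverlapping
expansions and costs one pass.  Reference: J. R. Shewchuk, Discrete Comput. Geom. 18 (1997) 305–363,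
§2.7 Theorem 23, §2.8 [Shewchuk1997].
-/

namespace Summit.Ventures.CertifiedArithmetic.Expansions

open Literature.ComputerArithmetic.JeannerodRump2018
open Literature.ComputerArithmetic.BoldoJeannerodMelquiondMuller2023 hiding twoSum twoSum_fst
open Literature.ComputerArithmetic.Shewchuk1997

variable {p : ℕ} {emin : ℤ} {fl : ℚ → ℚ}

/-- **ROUND-EXPANSION ∘ COMPRESS = `fl (Σ e)`** for every nonoverlapping expansion `e` of floats
(smallest component first, `IsExpansion 1 e`), `p ≥ 2`, any round-to-nearest `fl`. -/
theorem roundExpansion_compress (hp : 2 ≤ p) (hfl : IsRoundNearest p emin fl) {e : List ℚ}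
    (he : ∀ x ∈ e, IsFloat p emin x) (hexp : IsExpansion 1 e) :
    roundExpansion p emin fl (compress fl e) = fl e.sum := by
  have out := compress_nonoverlapping hp hfl he hexp
  rw [← out.sum_eq]
  rcases out.nz with hnz | hsingle
  · exact roundExpansion_eq_fl_sum hp hfl out.floats hnz out.exp
      (compress_penultimate_near hp hfl he hexp)
  · -- `compress fl e = [Σ e]`: then `Σ e` is a float and both sides are `Σ e`
    have hS : IsFloat p emin e.sum := out.floats e.sum (by rw [hsingle]; simp)
    rw [hsingle]
    simp [roundExpansion, fl_eq_self hfl hS]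

/-- The same with the input class in the paper's words: floating-point components, pairwise
nonoverlapping, sorted by increasing magnitude except that any component may be zero
[cite: Shewchuk1997, §2.1 p. 309] (dictionary `isExpansion_one_iff`). -/
theorem roundExpansion_compress' (hp : 2 ≤ p) (hfl : IsRoundNearest p emin fl) {e : List ℚ}
    (he : ∀ x ∈ e, IsFloat p emin x) (hno : e.Pairwise Nonoverlapping)
    (hinc : e.Pairwise (fun x y => x = 0 ∨ y = 0 ∨ |x| < |y|)) :
    roundExpansion p emin fl (compress fl e) = fl e.sum :=
  roundExpansion_compress hp hfl he ((isExpansion_one_iff he).mpr ⟨hno, hinc⟩)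

/-- The same on this development's class W of WEAKLY NONOVERLAPPING expansions — the class that
FAST-EXPANSION-SUM preserves (`WeakExpansion.lean`): e.g. the FAST-EXPANSION-SUM of two
nonoverlapping expansions, compressed and rounded, is the correctly rounded value of their sum. -/
theorem roundExpansion_compress_of_isWeakExpansion (hp : 2 ≤ p) (hfl : IsRoundNearest p emin fl)
    {e : List ℚ} (he : ∀ x ∈ e, IsFloat p emin x) (hW : IsWeakExpansion e) :
    roundExpansion p emin fl (compress fl e) = fl e.sum :=
  roundExpansion_compress hp hfl he hW.isExpansion

/-- Error form: the pipeline returns a float within half an ulp of the exact sum (`p ≥ 2`, any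
round-to-nearest) — where COMPRESS's own top component is only within one `ulp` (Theorem 23). -/
theorem abs_roundExpansion_compress_sub_sum_le (hp : 2 ≤ p) (hfl : IsRoundNearest p emin fl)
    {e : List ℚ} (he : ∀ x ∈ e, IsFloat p emin x) (hexp : IsExpansion 1 e) :
    IsFloat p emin (roundExpansion p emin fl (compress fl e)) ∧
      |e.sum - roundExpansion p emin fl (compress fl e)| ≤ ulp p emin e.sum / 2 := by
  rw [roundExpansion_compress hp hfl he hexp]
  exact ⟨(hfl e.sum).1, abs_sub_fl_le_half_ulp (le_trans (by norm_num) hp) hfl e.sum⟩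

end Summit.Ventures.CertifiedArithmetic.Expansions
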